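import Literature.IUT.HodgeTheaters.TemperedCoveringsProp2122Sub
import Literature.AnabelianGeometry.SemiGraphs.CuspOmissionSubgraph
import HarnessLib

/-!
# [IUTchI] Prop 2.2, cited input `hHatH` («C_{Π̂_𝔾}(Π̂_ℍ) = Π̂_ℍ», the evident pro-`Σ̂` analogue of [SemiAnbd] Cor 2.7 (i))
# DISCHARGED BY NAME from F-1458 at the cone's instantiation — GAP-LEDGER G-w5d028-1, kernel closure of disposition (i)

Mochizuki, *Inter-universal Teichmüller theory I*, kurims manuscript (May 2020) paper:url-690e7b3c6199, §2: p. 44 l. 24–31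
(«Π̂_𝔾 … the pro-Σ̂ [i.e., maximal pro-Σ̂ quotient of the profinite] fundamental group of 𝔾»; ℍ «is» a semi-graph of
anabelioids of pro-Σ PSC-type «up to the possible omission of some of the cuspidal edges») and Prop 2.2 proof p. 46
l. 9–11 («by the evident pro-Σ̂ analogue of [SemiAnbd], Corollary 2.7, (i) …, we have C_{Π̂_𝔾}(Π̂_ℍ) = Π̂_ℍ»)
[claim: Mochizuki2012, status: disputed] (nothing of the series is asserted); Mochizuki, *Semi-graphs of anabelioids*
(2006), Cor 2.7 (i) p. 30 = FACT-LIST F-1458 `Literature.AnabelianGeometry.SemiGraphs.SemiGraphOfAnabelioids.corollary_2_7_i`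
[cite: MochizukiSemiAnbd2006, Cor. 2.7(i) p.30].

PROOF-ONLY bridge (abc-iut cell, seat abc-iut-w5-d028 gen 2 — the lineage that filed GAP row G-w5d028-1 and its D-row
2026-08-26T00:39:35Z; no `def`, no new `Prop` fact). The D-row's disposition (i) said: at the cone's instantiation
(Σ = {l}, Σ̂ = 𝔓𝔯𝔦𝔪𝔢𝔰, [IUTchII] Prop 2.2 p. 66) the «maximal pro-Σ̂ quotient» Π̂_𝔾 IS π₁(B(𝔾)), so the hypothesis
`hHatH : IsCommensurablyTerminal D.HatH` of abc-iut-L5-t11's `prop22_of_prop21` / this lineage's `prop22_byName` (p413988) is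
F-1458 BY NAME modulo the p. 44 merge atoms. abc-iut-L3-t1 has since landed the cusp-omission atom as a KERNEL theorem with F-1458
as a named hypothesis (`SemiGraphOfAnabelioids.isCommensurablyTerminal_range_piHToPi_of_corollary_2_7_i`, p419508 ✓:
for 𝒢 connected WITH cusps, K ⊆ 𝔾 connected with a vertex, the cusp-omitted graph quasi-coherent and the vertices of K
elevated there, Π_K ⊆ Π_𝒢 is commensurably terminal). This file composes:

* `hatH_commTerminal_of_agreement` — transport: an AGREEMENT `eHat : Π̂_𝔾 ⥲ Π_𝒢` (abstract `D.Hat` of the interface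
  `TemperedGraphGroupData` vs the anabelioid fundamental group `𝒢.Pi`) carrying `Π̂_ℍ = D.HatH` onto the image `Π_K` of
  `piHToPi`, plus commensurable terminality of that image, gives `hHatH` (`isCommensurablyTerminal_map_iff_of_bijective`);
* **`hatH_commTerminal_of_corollary_2_7_i`** — hence `hHatH` ⟸ F-1458 `corollary_2_7_i` BY NAME + the agreement + the two
  remaining p. 44 atoms (`hq`: quasi-coherence of the cusp-omitted graph; `hel`: its vertices elevated — both consequences of
  «pro-Σ PSC-type», kept as the consumer's named hypotheses exactly as in p419508);
* **`prop22_byName_of_corollary_2_7_i`** — [IUTchI] Prop 2.2 AS TYPED (`CommensuratorsOfDecompositionSubgroups`, all four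
  clauses) with the cited input `hHatH` REPLACED by F-1458 + agreement + atoms; every other printed input stays BY NAME as in
  `prop22_byName`.

GAP-LEDGER: G-w5d028-1 disposition (i) is now a kernel theorem (cone case, Σ̂ = 𝔓𝔯𝔦𝔪𝔢𝔰, relative to the agreement datum
`eHat`/`hrange` — a MERGE touch: the L5 interface's abstract Π̂_𝔾 vs L3's π₁(B(𝒢)), owner L5-t1/L3 at the model); disposition
(iii) (general Σ̂ ⊋ Σ, not used by [IUTchII–III]) is untouched. HONEST FRAMING: conditional on the NAMED FACT F-1458 (unproved,
admissible) and on the listed data; no side taken on [IUTchIII] Cor 3.12; typed ≠ proved.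
-/

namespace Literature.IUT.HodgeTheaters

open CategoryTheory CategoryTheory.PreGaloisCategory
open Pointwise Topology
open Literature.AnabelianGeometry.SemiGraphs (IsProfiniteCompletion PSCDatum ProfiniteSemiGraph SemiGraphOfAnabelioids
  isCommensurablyTerminal_map_iff_of_bijective)
open Literature.AnabelianGeometry.SemiGraphs.ProfiniteSemiGraph (TemperedPiChart verticialSubgroups CompactInVerticial
  VerticialInjective)
open Literature.AnabelianGeometry.AbsoluteAnabelian (IsCommensurablyTerminal)

universe v₁ u₁ u' u

namespace TemperedGraphGroupData

variable (D : TemperedGraphGroupData.{u})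

/-- **Transport of `hHatH` along an agreement** ([IUTchI] p. 44 l. 24–27, «Π̂_𝔾 … the pro-Σ̂ fundamental group of 𝔾»,
at Σ̂ = 𝔓𝔯𝔦𝔪𝔢𝔰: Π̂_𝔾 = π₁(B(𝒢))): if a group isomorphism `eHat : D.Hat ≃* 𝒢.Pi` carries `Π̂_ℍ = D.HatH` onto the image
`Π_K` of `piHToPi K`, then commensurable terminality of `Π_K ⊆ Π_𝒢` gives `C_{Π̂_𝔾}(Π̂_ℍ) = Π̂_ℍ`.
([IUTchI] §2 p.44) [claim: Mochizuki2012, status: disputed] -/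
theorem hatH_commTerminal_of_agreement {𝒢 : SemiGraphOfAnabelioids.{v₁, u₁, u'}} (K : 𝒢.graph.Subgraph)
    (w : K.toSemiGraph.Vertex) (F : 𝒢.V w.1 ⥤ FintypeCat.{v₁}) [FiberFunctor F]
    (eHat : D.Hat ≃* 𝒢.Pi w.1 F) (hrange : D.HatH.map eHat.toMonoidHom = (𝒢.piHToPi K w F).range)
    (h : IsCommensurablyTerminal (𝒢.piHToPi K w F).range) :
    IsCommensurablyTerminal D.HatH := by
  rw [← isCommensurablyTerminal_map_iff_of_bijective eHat.toMonoidHom eHat.bijective, hrange]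
  exact h

/-- **[IUTchI] Prop 2.2, cited input `hHatH` FROM F-1458 BY NAME** (p. 46 l. 9–11 «by the evident pro-Σ̂ analogue of
[SemiAnbd], Corollary 2.7, (i) … C_{Π̂_𝔾}(Π̂_ℍ) = Π̂_ℍ», at the cone's Σ̂ = 𝔓𝔯𝔦𝔪𝔢𝔰): for 𝒢 a connected semi-graph of
anabelioids WITH cusps (p. 44 «up to the possible omission of some of the cuspidal edges»), K ⊆ 𝔾 a connected
sub-semi-graph with a vertex, the cusp-omitted graph quasi-coherent (`hq`) with the vertices of K elevated (`hel`), an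
agreement `eHat`/`hrange` as above, and the NAMED FACT `corollary_2_7_i` (F-1458, [SemiAnbd] Cor 2.7 (i)), the interface
hypothesis `hHatH` holds — via abc-iut-L3-t1's cusp-omission theorem (p419508).
([IUTchI] Prop 2.2 p.46) [claim: Mochizuki2012, status: disputed] -/
theorem hatH_commTerminal_of_corollary_2_7_i (h27 : SemiGraphOfAnabelioids.corollary_2_7_i.{v₁, u₁, u'})
    {𝒢 : SemiGraphOfAnabelioids.{v₁, u₁, u'}} (h𝒢 : 𝒢.IsConnected)
    (hq : (𝒢.restrict 𝒢.graph.maximalSubgraph).IsQuasiCoherent)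
    (K : 𝒢.graph.Subgraph) (hK : K.toSemiGraph.IsConnected) (w : K.toSemiGraph.Vertex)
    (hel : ∀ v : K.toSemiGraph.Vertex, (𝒢.restrict 𝒢.graph.maximalSubgraph).IsElevated ⟨v.1, trivial⟩)
    (F : 𝒢.V w.1 ⥤ FintypeCat.{v₁}) [FiberFunctor F]
    (eHat : D.Hat ≃* 𝒢.Pi w.1 F) (hrange : D.HatH.map eHat.toMonoidHom = (𝒢.piHToPi K w F).range) :
    IsCommensurablyTerminal D.HatH :=
  D.hatH_commTerminal_of_agreement K w F eHat hrange
    (SemiGraphOfAnabelioids.isCommensurablyTerminal_range_piHToPi_of_corollary_2_7_i h27 h𝒢 hq K hK w hel F)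

variable {𝒢 𝒢H : ProfiniteSemiGraph.{u}}

/-- **[IUTchI] Prop 2.2 AS TYPED with `hHatH` DISCHARGED BY NAME from F-1458**: this lineage's `prop22_byName`
(p413988 — every printed input of the proof of Prop 2.2 by name: the charts of π₁^temp for 𝔾 and ℍ, [SemiAnbd] Thm 3.7
(i)/(iii) facts `CompactInVerticial`/`VerticialInjective`, profinite-completion and Galois atoms, the [NodNon] PSC incidence data)
with its ONE cited input `hHatH` replaced by the NAMED FACT `corollary_2_7_i` (F-1458) + the agreement `eHat`/`hrange` of Π̂_𝔾
with π₁(B(𝒢)) + the p. 44 atoms `hq`/`hel` on the cusp-omitted graph. Closes GAP-LEDGER G-w5d028-1 disposition (i) in the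
kernel (cone case). ([IUTchI] Prop 2.2 pp.45–46) [claim: Mochizuki2012, status: disputed] -/
theorem prop22_byName_of_corollary_2_7_i [T2Space D.Tp] (hcH : IsClosed (D.HatH : Set D.Hat))
    -- the `𝔾`-datum, as in `prop21_byName`
    (c : TemperedPiChart 𝒢) (e : D.Tp ≃ₜ* c.G) (h𝒢 : 𝒢.Thm37Hypotheses)
    (hCV : CompactInVerticial.{u}) (hVI : VerticialInjective.{u})
    (hPC : IsProfiniteCompletion
      ({ toMonoidHom := D.ι, continuous_toFun := D.ι_continuous } : D.Tp →ₜ* D.Hat))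
    (hGal : ∀ S : ProfiniteSemiGraph.BTempCat 𝒢,
      Literature.AlgebraicGeometry.Frobenioids.IsConnectedObj S →
      ∃ (H : ProfiniteSemiGraph.BTempCat 𝒢) (_ : H ⟶ S),
        Literature.AnabelianGeometry.SemiGraphs.IsGaloisObj H ∧
          Group.ResiduallyFinite (CategoryTheory.Aut H))
    (G : PSCDatum D.Hat) (hNN : G.VerticialIntersectionNear) (σ : 𝒢.graph.Vertex ≃ G.graph.V)
    (Λv : G.graph.V → Subgroup D.Tp)
    (hvert : ∀ v : 𝒢.graph.Vertex, (Λv (σ v)).map (e : D.Tp →* c.G) ∈ verticialSubgroups c v)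
    (hΛv : ∀ v, (Λv v).map D.ι = G.vertGp v)
    (src tgt : G.graph.N → G.graph.V) (c₁ c₂ : G.graph.N → D.Tp)
    (hends : ∀ e, G.graph.nodeEnds e = s(src e, tgt e))
    (h₁ : ∀ e, G.nodeGp e ≤ MulAut.conj (D.ι (c₁ e)) • G.vertGp (src e))
    (h₂ : ∀ e, G.nodeGp e ≤ MulAut.conj (D.ι (c₂ e)) • G.vertGp (tgt e))
    (hloop : ∀ e, src e = tgt e → (c₁ e)⁻¹ * c₂ e ∉ Λv (src e))
    -- the `ℍ`-datum `D.restrictH hcH`, likewise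
    (cH : TemperedPiChart 𝒢H) (eH : (D.restrictH hcH).Tp ≃ₜ* cH.G) (h𝒢H : 𝒢H.Thm37Hypotheses)
    (hPCH : IsProfiniteCompletion
      ({ toMonoidHom := (D.restrictH hcH).ι, continuous_toFun := (D.restrictH hcH).ι_continuous } :
        (D.restrictH hcH).Tp →ₜ* (D.restrictH hcH).Hat))
    (hGalH : ∀ S : ProfiniteSemiGraph.BTempCat 𝒢H,
      Literature.AlgebraicGeometry.Frobenioids.IsConnectedObj S →
      ∃ (H : ProfiniteSemiGraph.BTempCat 𝒢H) (_ : H ⟶ S),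
        Literature.AnabelianGeometry.SemiGraphs.IsGaloisObj H ∧
          Group.ResiduallyFinite (CategoryTheory.Aut H))
    (GH : PSCDatum (D.restrictH hcH).Hat) (hNNH : GH.VerticialIntersectionNear)
    (σH : 𝒢H.graph.Vertex ≃ GH.graph.V)
    (ΛvH : GH.graph.V → Subgroup (D.restrictH hcH).Tp)
    (hvertH : ∀ v : 𝒢H.graph.Vertex,
      (ΛvH (σH v)).map (eH : (D.restrictH hcH).Tp →* cH.G) ∈ verticialSubgroups cH v)
    (hΛvH : ∀ v, (ΛvH v).map (D.restrictH hcH).ι = GH.vertGp v)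
    (srcH tgtH : GH.graph.N → GH.graph.V) (c₁H c₂H : GH.graph.N → (D.restrictH hcH).Tp)
    (hendsH : ∀ e, GH.graph.nodeEnds e = s(srcH e, tgtH e))
    (h₁H : ∀ e, GH.nodeGp e ≤ MulAut.conj ((D.restrictH hcH).ι (c₁H e)) • GH.vertGp (srcH e))
    (h₂H : ∀ e, GH.nodeGp e ≤ MulAut.conj ((D.restrictH hcH).ι (c₂H e)) • GH.vertGp (tgtH e))
    (hloopH : ∀ e, srcH e = tgtH e → (c₁H e)⁻¹ * c₂H e ∉ ΛvH (srcH e))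
    -- the cited input, now BY NAME from F-1458 + agreement + p.44 atoms
    (h27 : SemiGraphOfAnabelioids.corollary_2_7_i.{v₁, u₁, u'}) {𝒜 : SemiGraphOfAnabelioids.{v₁, u₁, u'}} (h𝒜 : 𝒜.IsConnected)
    (hq : (𝒜.restrict 𝒜.graph.maximalSubgraph).IsQuasiCoherent)
    (K : 𝒜.graph.Subgraph) (hK : K.toSemiGraph.IsConnected) (w : K.toSemiGraph.Vertex)
    (hel : ∀ v : K.toSemiGraph.Vertex, (𝒜.restrict 𝒜.graph.maximalSubgraph).IsElevated ⟨v.1, trivial⟩)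
    (F : 𝒜.V w.1 ⥤ FintypeCat.{v₁}) [FiberFunctor F]
    (eHat : D.Hat ≃* 𝒜.Pi w.1 F) (hrange : D.HatH.map eHat.toMonoidHom = (𝒜.piHToPi K w F).range) :
    D.CommensuratorsOfDecompositionSubgroups :=
  D.prop22_byName hcH c e h𝒢 hCV hVI hPC hGal G hNN σ Λv hvert hΛv src tgt c₁ c₂ hends h₁ h₂ hloop
    cH eH h𝒢H hPCH hGalH GH hNNH σH ΛvH hvertH hΛvH srcH tgtH c₁H c₂H hendsH h₁H h₂H hloopH
    (D.hatH_commTerminal_of_corollary_2_7_i h27 h𝒜 hq K hK w hel F eHat hrange)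

end TemperedGraphGroupData

end Literature.IUT.HodgeTheaters
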